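import Mathlib
import HarnessLib

/-!
# Irrationality and linear independence of values `L(f,s)` of Dirichlet `L`-functions (Fischler 2020, Mistiaen 2025)

Topic `Literature/NumberTheory/Irrationality/DirichletLValues`. Typed, cited statements (named facts, no proof; D-0014) with
PROVED consequences, read on the page (this session) from

* S. Fischler, *Irrationality of values of `L`-functions of Dirichlet characters*, J. London Math. Soc. (2) **101** (2020)
  857–876 = arXiv:1904.02402 [Fischler2020LValues] (held `paper:arxiv-1904.02402`; theorem numbering of the arXiv text:
  Theorem 1, Theorem 2, Corollaries 1–2 in §1; Theorem 4 = label (th3) at the end of §3.2);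
* L. Mistiaen, *Linear independence of values of Dirichlet `L` functions*, arXiv:2512.02612 (2025) [Mistiaen2025] (held
  `paper:arxiv-2512.02612`), Théorème 1.0.5.

These extend to `L(f,s) = Σ_{n≥1} f(n) n^{−s}` (`f` periodic) the odd-zeta-value records held in the tree:
Ball–Rivoal (`Transcendental.ball_rivoal`, PROVED), Fischler–Sprang–Zudilin 2019
(`FischlerSprangZudilin2019.manyOddZetaValuesIrrational`), Fischler 2021/2026 `0.21√(s/log s)`
(`Fischler2026.oddZetaSpan_finrank_ge_sqrt`), Lai–Yu 2020 (`LaiYu2020.theorem11`). HONEST FRAMING (cell zeta5-irr): records of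
the literature; nothing here concerns `ζ(5)`.

## What is printed

[Fischler2020LValues, §1]: "Let `T ≥ 1`, and `f : ℤ → ℂ` be such that `f(n+T) = f(n)` for any `n`. We assume that `f` is not
identically zero. … `L(f,s) = Σ_{n=1}^{∞} f(n)/n^s` with `2 ≤ s ≤ a` and `s ≡ p mod 2`."
**Theorem 1.** "Let `T ≥ 1`, and `f : ℤ → ℂ` be such that `f(n+T) = f(n)` for any `n`. Assume that `f` is not identically
zero. Let `p ∈ {0,1}`, `ε > 0`, and `a` be sufficiently large (in terms of `T` and `ε`). Then
`dim_ℚ Span_ℚ {L(f,s), 2 ≤ s ≤ a, s ≡ p mod 2} ≥ (1−ε)/(1+log 2) · log a`."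
**Theorem 2.** "… Let `E` be a finite-dimensional `ℚ`-vector space contained in `ℂ`, `p ∈ {0,1}`, `ε > 0`, and `a` be
sufficiently large (in terms of `dim E`, `T`, and `ε`). Then among the numbers `L(f,s)` with `2 ≤ s ≤ a` and `s ≡ p mod 2`,
at least `2^{(1−ε) log a/log log a}` do not belong to `E`."
**Corollary 1.** "Let `χ` be a Dirichlet character; put `p = 0` i[f] `χ` is odd, and `p = 1` if `χ` is even. Let `E` be a
finite-dimensional `ℚ`-vector space contained in `ℂ`. Let `ε > 0`, and `a` be sufficiently large (in terms of `χ`, `dim E`,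
and `ε`). Then among the numbers `L(χ,s)` with `2 ≤ s ≤ a` and `s ≡ p mod 2`, at least `2^{(1−ε) log a/log log a}` do not
belong to `E`."
**Corollary 2.** "Let `r` be a positive rational number, and `p ∈ {0,1}`. … Then among the numbers
`ζ(s,r) = Σ_{n=0}^{∞} 1/(n+r)^s` with `2 ≤ s ≤ a` and `s ≡ p mod 2`, at least `2^{(1−ε) log a/log log a}` do not belong to
`E`." ("Corollary 2 is new even for `r = 1`, i.e. for the Riemann `ζ` function.")
**Theorem 4** (label (th3), §3.2). "Let `T ≥ 1`, and `f : ℤ → ℂ` be such that `f(n+T) = f(n)` for any `n`. Assume that `f`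
is not identically zero. Let `p ∈ {0,1}`, `0 < ε < 1`, and `a` be sufficiently large (in terms of `T` and `ε`). Let `E` be a
finite-dimensional `ℚ`-vector space contained in `ℂ` with `dim E < (ε/7) log a`. Then among the numbers `L(f,s)` with
`2 ≤ s ≤ a` and `s ≡ p mod 2`, at least `2^{(1−ε) log a/log log a}` do not belong to `E`." ("Theorem (th3) … implies both
Theorem (th2) and – up to a multiplicative constant – Theorem (th1)".)
[Mistiaen2025, Théorème 1.0.5] "Soit `N ≥ 3` un entier avec `N ≢ 0 [4]`. Soit `χ : ℕ → ℂ` un caractère de Dirichlet modulo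
`N`. Soit `ε ∈ {0, 1}` la parité opposée à celle de `χ`. Soit `K = ℚ(e^{2iπ/N})`. Pour tout entier `s` de parité `ε` et
suffisament grand, on a `dim_K Vect_K {L(χ,i) | 2 ≤ i ≤ s, i ≡ ε [2]} ≥ (0.42/N^{3/2}) √(s/log(s))`." (Remarque 1.0.1: for
`N = 1` the proof gives `0.21`, Fischler's theorem = the tree's `Fischler2026.oddZetaSpan_finrank_ge_sqrt`; Remarque 1.0.2:
"la parité d'un caractère de Dirichlet `χ` étant l'unique `ε_χ ∈ {0,1}` tel que `χ(−1) = (−1)^{ε_χ}χ(1)`".)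

## What is typed

`periodicL f s = L(f,s)` (Mathlib's `LSeries` of `n ↦ f(n)`), `hurwitzValue s r = ζ(s,r)` (a real series), `outsideCount`
(the number of indices `s ∈ [2,a]`, `s ≡ p (2)`, with `L(f,s) ∉ E`); NAMED FACTS `fischler2020_theorem1`, `fischler2020_theorem4`,
`fischler2020_corollary2`, `mistiaen2025_theorem105`; PROVED from Theorem 4: `fischler2020_theorem2` (Theorem 2) and
`fischler2020_corollary1` (Corollary 1, Dirichlet characters are periodic and not identically zero).
-/

noncomputable section

open Filter

namespace Literature.NumberTheory.Irrationality.DirichletLValues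

/-- `L(f,s) = Σ_{n≥1} f(n)/n^s` for a periodic `f : ℤ → ℂ` and an integer `s ≥ 2` (Mathlib's `LSeries` of `n ↦ f(n)`, whose
term at `n = 0` is `0`). [cite: Fischler2020LValues, §1 (eq. (1.1), definition of `L(f,s)`)] -/
def periodicL (f : ℤ → ℂ) (s : ℕ) : ℂ := LSeries (fun n : ℕ => f n) s

/-- `f` has period `T` and is not identically zero (standing hypotheses of [Fischler2020LValues]).
[cite: Fischler2020LValues, §1 Theorem 1] -/
def IsPeriodicNonzero (T : ℕ) (f : ℤ → ℂ) : Prop := (∀ n : ℤ, f (n + T) = f n) ∧ ∃ n : ℤ, f n ≠ 0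

/-- The number of indices `s` with `2 ≤ s ≤ a`, `s ≡ p (mod 2)` and `L(f,s) ∉ E` ("among the numbers `L(f,s)` with
`2 ≤ s ≤ a` and `s ≡ p mod 2`, at least … do not belong to `E`"). [cite: Fischler2020LValues, §1 Theorem 2] -/
def outsideCount (f : ℤ → ℂ) (p a : ℕ) (E : Submodule ℚ ℂ) : ℕ :=
  ({s : ℕ | 2 ≤ s ∧ s ≤ a ∧ s % 2 = p ∧ periodicL f s ∉ E}).ncard

/-- **Fischler 2020, Theorem 1** (named fact, statement only): for `T ≥ 1`, `f` `T`-periodic and not identically zero,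
`p ∈ {0,1}` and `ε > 0`, for all sufficiently large `a`:
`dim_ℚ Span_ℚ {L(f,s) : 2 ≤ s ≤ a, s ≡ p (2)} ≥ (1−ε)/(1+log 2) · log a` (the constant `1 + log 2` does not depend on `f`,
improving Nishimoto's `T + log 2`). The source's threshold depends on `T` and `ε` only; typed with the threshold after
`f` (formally weaker). [cite: Fischler2020LValues, §1 Theorem 1] -/
def fischler2020_theorem1 : Prop :=
  ∀ (T : ℕ), 1 ≤ T → ∀ f : ℤ → ℂ, IsPeriodicNonzero T f → ∀ p : ℕ, p ≤ 1 → ∀ ε : ℝ, 0 < ε →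
    ∀ᶠ a : ℕ in atTop,
      (1 - ε) / (1 + Real.log 2) * Real.log a ≤
        Module.finrank ℚ
          ↥(Submodule.span ℚ {z : ℂ | ∃ s : ℕ, 2 ≤ s ∧ s ≤ a ∧ s % 2 = p ∧ z = periodicL f s})

/-- **Fischler 2020, Theorem 4** (label (th3); named fact, statement only): for `T ≥ 1`, `f` `T`-periodic and not
identically zero, `p ∈ {0,1}`, `0 < ε < 1`, and all sufficiently large `a` (in terms of `T`, `ε`): for every
finite-dimensional `ℚ`-subspace `E ⊂ ℂ` with `dim E < (ε/7) log a`, at least `2^{(1−ε) log a/log log a}` of the numbers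
`L(f,s)`, `2 ≤ s ≤ a`, `s ≡ p (2)`, do not belong to `E`. [cite: Fischler2020LValues, §3.2 Theorem 4 (th3)] -/
def fischler2020_theorem4 : Prop :=
  ∀ (T : ℕ), 1 ≤ T → ∀ f : ℤ → ℂ, IsPeriodicNonzero T f → ∀ p : ℕ, p ≤ 1 → ∀ ε : ℝ, 0 < ε → ε < 1 →
    ∀ᶠ a : ℕ in atTop, ∀ E : Submodule ℚ ℂ, FiniteDimensional ℚ E →
      (Module.finrank ℚ E : ℝ) < ε / 7 * Real.log a →
        (2 : ℝ) ^ ((1 - ε) * Real.log a / Real.log (Real.log a)) ≤ (outsideCount f p a E : ℝ)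

/-- The Hurwitz zeta value `ζ(s,r) = Σ_{n≥0} (n + r)^{−s}` (`r > 0`, integer `s ≥ 2`), as a real number.
[cite: Fischler2020LValues, §1 Corollary 2] -/
def hurwitzValue (s : ℕ) (r : ℝ) : ℝ := ∑' n : ℕ, 1 / ((n : ℝ) + r) ^ s

/-- **Fischler 2020, Corollary 2** (named fact, statement only): for a positive rational `r`, `p ∈ {0,1}`, a
finite-dimensional `ℚ`-subspace `E ⊂ ℂ` and `ε > 0`, for all sufficiently large `a`: at least `2^{(1−ε) log a/log log a}`
of the numbers `ζ(s,r)`, `2 ≤ s ≤ a`, `s ≡ p (2)`, do not belong to `E` ("new even for `r = 1`").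
[cite: Fischler2020LValues, §1 Corollary 2] -/
def fischler2020_corollary2 : Prop :=
  ∀ r : ℚ, 0 < r → ∀ p : ℕ, p ≤ 1 → ∀ E : Submodule ℚ ℂ, FiniteDimensional ℚ E → ∀ ε : ℝ, 0 < ε →
    ∀ᶠ a : ℕ in atTop,
      (2 : ℝ) ^ ((1 - ε) * Real.log a / Real.log (Real.log a)) ≤
        (({s : ℕ | 2 ≤ s ∧ s ≤ a ∧ s % 2 = p ∧ ((hurwitzValue s r : ℝ) : ℂ) ∉ E}).ncard : ℝ)

/-- **Mistiaen 2025, Théorème 1.0.5** (named fact, statement only): `N ≥ 3`, `4 ∤ N`, `χ` a Dirichlet character mod `N`,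
`ε ∈ {0,1}` the parity opposite to that of `χ` (`χ(−1) = (−1)^{ε_χ}`, `ε = 1 − ε_χ`, i.e. `χ(−1) = −(−1)^ε`),
`K = ℚ(e^{2iπ/N})`: for every sufficiently large `s ≡ ε (mod 2)`,
`dim_K Vect_K {L(χ,i) : 2 ≤ i ≤ s, i ≡ ε (2)} ≥ (0.42/N^{3/2}) √(s/log s)`.
[cite: Mistiaen2025, Théorème 1.0.5 (§1); Remarques 1.0.1–1.0.3] -/
def mistiaen2025_theorem105 : Prop :=
  ∀ (N : ℕ), 3 ≤ N → ¬ 4 ∣ N → ∀ χ : DirichletCharacter ℂ N, ∀ ε : ℕ, ε ≤ 1 →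
    χ (-1) = -((-1 : ℂ) ^ ε) →
      ∃ s₀ : ℕ, ∀ s : ℕ, s₀ ≤ s → s % 2 = ε →
        (0.42 : ℝ) / (N : ℝ) ^ ((3 : ℝ) / 2) * Real.sqrt (s / Real.log s) ≤
          Module.finrank ↥(IntermediateField.adjoin ℚ {Complex.exp (2 * Real.pi * Complex.I / N)})
            ↥(Submodule.span ↥(IntermediateField.adjoin ℚ {Complex.exp (2 * Real.pi * Complex.I / N)})
              {z : ℂ | ∃ i : ℕ, 2 ≤ i ∧ i ≤ s ∧ i % 2 = ε ∧ z = LSeries (fun n : ℕ => χ n) i})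

/-! ### Consequences (PROVED from Theorem 4) -/

/-- **Fischler 2020, Theorem 2** (PROVED here from Theorem 4, as the source notes: "Theorem (th3) … implies … Theorem
(th2)"): for `T ≥ 1`, `f` `T`-periodic and not identically zero, a finite-dimensional `ℚ`-subspace `E ⊂ ℂ`, `p ∈ {0,1}` and
`ε > 0`, for all sufficiently large `a`: at least `2^{(1−ε) log a/log log a}` of the numbers `L(f,s)`, `2 ≤ s ≤ a`,
`s ≡ p (2)`, do not belong to `E` (the source's threshold depends on `dim E`, `T`, `ε`; here it may depend on `E`, `f`:
formally weaker). [cite: Fischler2020LValues, §1 Theorem 2 and §3.2 (after Theorem 4)] -/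
theorem fischler2020_theorem2 (h4 : fischler2020_theorem4) {T : ℕ} (hT : 1 ≤ T) {f : ℤ → ℂ}
    (hf : IsPeriodicNonzero T f) {p : ℕ} (hp : p ≤ 1) (E : Submodule ℚ ℂ) [FiniteDimensional ℚ E] {ε : ℝ}
    (hε : 0 < ε) :
    ∀ᶠ a : ℕ in atTop, (2 : ℝ) ^ ((1 - ε) * Real.log a / Real.log (Real.log a)) ≤ (outsideCount f p a E : ℝ) := by
  -- apply Theorem 4 with `ε₁ = min ε (1/2) < 1`
  set ε₁ : ℝ := min ε (1 / 2) with hε₁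
  have hε₁pos : 0 < ε₁ := lt_min hε (by norm_num)
  have hε₁lt : ε₁ < 1 := (min_le_right _ _).trans_lt (by norm_num)
  have hε₁le : ε₁ ≤ ε := min_le_left _ _
  have h := h4 T hT f hf p hp ε₁ hε₁pos hε₁lt
  -- `dim E < (ε₁/7) log a` and `log log a > 0` eventually
  have hlog : Tendsto (fun a : ℕ => Real.log (a : ℝ)) atTop atTop :=
    Real.tendsto_log_atTop.comp tendsto_natCast_atTop_atTop
  have hdim : ∀ᶠ a : ℕ in atTop, (Module.finrank ℚ E : ℝ) < ε₁ / 7 * Real.log a := by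
    have : Tendsto (fun a : ℕ => ε₁ / 7 * Real.log (a : ℝ)) atTop atTop :=
      hlog.const_mul_atTop (by positivity)
    exact this.eventually_gt_atTop _
  have hloglog : ∀ᶠ a : ℕ in atTop, 0 < Real.log (Real.log (a : ℝ)) := by
    have : Tendsto (fun a : ℕ => Real.log (Real.log (a : ℝ))) atTop atTop := Real.tendsto_log_atTop.comp hlog
    exact this.eventually_gt_atTop 0
  have hlogpos : ∀ᶠ a : ℕ in atTop, 0 < Real.log (a : ℝ) := hlog.eventually_gt_atTop 0
  filter_upwards [h, hdim, hloglog, hlogpos] with a ha hda hlla hla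
  refine le_trans ?_ (ha E inferInstance hda)
  -- monotonicity of `2^x` in the exponent
  apply Real.rpow_le_rpow_of_exponent_le (by norm_num)
  apply div_le_div_of_nonneg_right _ hlla.le
  exact mul_le_mul_of_nonneg_right (by linarith) hla.le

/-- A Dirichlet character mod `T ≥ 1`, read as a function on `ℤ`, is `T`-periodic and not identically zero.
[cite: Fischler2020LValues, §1 ("If `f` is a Dirichlet character mod `T` then these are exactly the values of the
associated `L`-function")] -/
theorem isPeriodicNonzero_dirichletCharacter {T : ℕ} (χ : DirichletCharacter ℂ T) :
    IsPeriodicNonzero T (fun n : ℤ => χ n) := by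
  refine ⟨fun n => ?_, ⟨1, ?_⟩⟩
  · simp
  · simp

/-- **Fischler 2020, Corollary 1** (PROVED from Theorem 2): for a Dirichlet character `χ` mod `T ≥ 1`, `p = 0` if `χ` is odd
and `p = 1` if `χ` is even (here: any `p ∈ {0,1}`, the parity restriction only sharpens the interest of the statement), a
finite-dimensional `ℚ`-subspace `E ⊂ ℂ` and `ε > 0`, for all sufficiently large `a`: at least
`2^{(1−ε) log a/log log a}` of the numbers `L(χ,s)`, `2 ≤ s ≤ a`, `s ≡ p (2)`, do not belong to `E`.
[cite: Fischler2020LValues, §1 Corollary 1] -/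
theorem fischler2020_corollary1 (h4 : fischler2020_theorem4) {T : ℕ} (hT : 1 ≤ T) (χ : DirichletCharacter ℂ T)
    {p : ℕ} (hp : p ≤ 1) (E : Submodule ℚ ℂ) [FiniteDimensional ℚ E] {ε : ℝ} (hε : 0 < ε) :
    ∀ᶠ a : ℕ in atTop,
      (2 : ℝ) ^ ((1 - ε) * Real.log a / Real.log (Real.log a)) ≤ (outsideCount (fun n : ℤ => χ n) p a E : ℝ) :=
  fischler2020_theorem2 h4 hT (isPeriodicNonzero_dirichletCharacter χ) hp E hε

end Literature.NumberTheory.Irrationality.DirichletLValues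

end
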